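import Summits.QuantumFields.BalabanUV.T4Continuum.Support.NE3SlicePoincareCurved
import Summits.QuantumFields.BalabanUV.T4Continuum.Support.NE3SlicePoincareBudgetWitness
import Summits.QuantumFields.BalabanUV.T4Continuum.Support.NE3FlatHessianCurl
import Summits.QuantumFields.BalabanUV.T4Continuum.Support.MinimalActionWitness
import HarnessLib

/-!
# NE3SlicePoincareLevelOne (T⁴ programme, node NE3, row K6 of ruling ρ-g22-2, route H♮) — (P♮)_W AT LEVEL ONE WITH EVERY DISPLAYED
# NUMERIC HYPOTHESIS DISCHARGED IN THE KERNEL (d = 4, L = 2, card n = 2)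

NE3 (node U1b) formalisation swarm, leaf seat `b2b-balaban-t4-ne3-formalise-leaf-03` (gen 10), companion of «K6c-2-NV»
`NE3SlicePoincareBudgetWitness` (INTENT `HOME/CLAIMS.log` l.21705).  leaf-02's (P♮)_W END `NE3SlicePoincareCurved.slicePoincare_frameFreeBlockLandauW`
(p237604) carries, besides the tower-class binders on `W`, SEVEN real-number hypotheses: `hx : 0 ≤ x`, `hs : LevelSmall d L k x`,
`hS2 : S2sum d L (k+1) x ≤ rho d L ∕ 2`, K6-Ξ's `hsmall`, `hε : 0 < ε`, and the two budget lines `hSh` («SMALL-h»), `hSy` («SMALL-y»).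
THIS FILE instantiates ALL SEVEN at `d = 4`, `L = 2`, `k = 0`, `Fintype.card n = 2`, `x = 10⁻⁵³`, `ε = 10⁻¹⁷` from `NE3SlicePoincareBudgetWitness`
(`levelSmall_level_one`, `S2sum_le_half_rho_level_one`, `xi_small_level_one`, `budget_lines_hold_level_one`) and records
**`slicePoincare_level_one`**: for every `N ≥ 1` and every unitary `W : Site 4 → Fin 4 → (Matrix n n ℂ)ˣ` of period `tower 2 N 1` with
`SmallField W 10⁻⁵³`, `SlicePoincare 2 (0+1) W (frameFreeBlockLandauW 2 N (0+1) W) C₁ (periodBox (N·2^(0+1)))` with the END's constant `C₁` at that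
point — i.e. THE (P♮)_W END IS NON-VACUOUS ON ITS NUMERIC SIDE: its smallness hypotheses are met by an explicit point of the class radius, in
the kernel (the two-engine census NUM-ne3leaf03g10-1 ∕ D-ne3r2-g10-3 says the same k-FREE; NE3-R2 g11's K-g11-1 `NE3SlicePoincareBudgetLine`
is the k-free kernel version to come).  §2 `slicePoincare_level_one_flat`: the HYPOTHESIS-FREE inhabitant — §1 at `n = Fin 2`, `N = 1`,
`W = flatCfg` (unitary, periodic, `SmallField flatCfg 0`), the referee's INFO-68 probe (pass 27, part b) now as a tree theorem.  §3 `slicePoincare_level_one_three`: §1 at `Fintype.card n = 3`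
(SU(3)) from the witness file's v1.1 (`…_three`).  All [folklore], 0 def, 0 sorry.
HONEST FRAMING.  One level (k = 0), one point (x, ε); the statement is leaf-02's (P♮)_W with numbers plugged in — OUR bookkeeping on OUR lattice
objects; nothing about Bałaban's minimisers; (ML_w) at `W ≠ 1` follows only through the owner's junction; T-E_w♯ and **NE3 are NOT proved**;
spine PROVED 0∕9; finite T⁴ rung (B)+1 — NOT infinite volume, NOT mass gap, NOT BetaPertH, NOT Clay.  ABSOLUTE RULE kept.  PLACEMENT:
`Summits/QuantumFields/BalabanUV/`; imports accepted modules only; moves nothing.  HONEST DEPENDENCY: continuum YM on T⁴ ⇐ BetaPertH ∧ nine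
spine estimates (0/9 proved); BetaPertH ⇐ (D1) ∧ (D4) ∧ CAP+tail; G-an2-4 gates asym, D1 and NE2/3/4.
-/

set_option autoImplicit false

namespace Summit.QuantumFields.BalabanUV.T4Continuum.NE3SlicePoincareLevelOne

open Literature.MathematicalPhysics.QuantumFieldTheory.Balaban1983to89
open B7Prop1Explicit
open T4AveragingDeficitWall (IsUnitaryCfg SmallField)
open T4AveragingDeficitWallBoundary (IsPeriodicCfg periodBox)
open AveragingDeficitTwoLevelPrep (prop1Radius)
open AveragingDeficitMultiLevelPrep (LevelSmall radIter tower)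
open NE3CovariantLineSumsL2Tower (rho S2sum)
open NE3ExactLineSumsTower (DSum)
open SpreadLift (loopRad)
open NE3FrameFreeSliceW (frameFreeBlockLandauW)
open NE3SlicePoincareShape (SlicePoincare)
open NE3SlicePoincareBudgetWitness (levelSmall_level_one S2sum_le_half_rho_level_one xi_small_level_one budget_lines_hold_level_one
  xi_small_level_one_three budget_lines_hold_level_one_three)
open NE3FlatHessianCurl (isUnitaryCfg_flatCfg smallField_flatCfg_zero)
open MinimalActionWitness (flatCfg isPeriodicCfg_flatCfg)

noncomputable section

/-! ## §1 (P♮)_W at level one, numeric side discharged -/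

/-- **(P♮)_W AT LEVEL ONE, NUMERIC SIDE DISCHARGED**: K6c-2b `slicePoincare_frameFreeBlockLandauW` at `d = 4`, `L = 2`, `k = 0`,
`Fintype.card n = 2`, `x = 10⁻⁵³`, `ε = 10⁻¹⁷`, with `hx`, `hs`, `hS2`, `hsmall`, `hε`, `hSh`, `hSy` ALL supplied by
`NE3SlicePoincareBudgetWitness`; what remains are `N ≥ 1` and the tower-class binders on `W` (unitary, periodic, `SmallField W x`).
The displayed conclusion is K6c-2b's own `SlicePoincare …` term at that point (generated from the tree statement by token
substitution `d ↦ 4`, `L ↦ 2`, `k ↦ 0`, `x ↦ 1/10^53`, `ε ↦ 1/10^17`; not retyped by hand). [folklore] -/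
theorem slicePoincare_level_one {n : Type*} [Fintype n] [DecidableEq n] [Nonempty n] (hn : Fintype.card n = 2)
    {N : ℕ} (hN : 1 ≤ N) {W : Site 4 → Fin 4 → (Matrix n n ℂ)ˣ} (hWu : IsUnitaryCfg W)
    (hWP : IsPeriodicCfg W ((tower 2 N (0 + 1) : ℕ) : ℤ)) (hWx : SmallField W (1 / 10 ^ 53)) :
    SlicePoincare (2 : ℕ) (0 + 1) W (frameFreeBlockLandauW (d := 4) (n := n) (2 : ℕ) N (0 + 1) W)
      ((Fintype.card n : ℝ) * (16 * (18 + 1 / 4 +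
      16 * (2 * (8 * loopRad (4 : ℕ) (2 : ℕ) ((prop1Radius (4 : ℕ) (2 : ℕ))^[0] (1 / 10 ^ 53 : ℝ))) + 2 * (2 * ((((4 : ℕ) : ℝ) - 1) * ((((2 : ℕ) : ℝ)
      ^ (0 + 1)) - 1) * (((2 : ℕ) : ℝ) ^ (0 + 1)) * (1 / 10 ^ 53 : ℝ)))) * (Real.sqrt ((Fintype.card n : ℝ))) / (1 / 10 ^ 17 : ℝ) ^ 2) * (1 + (1 + 8
      * (1 / 10 ^ 17 : ℝ)) * (2 + (16 * ((4 : ℕ) : ℝ) * (1 / (((2 : ℕ) : ℝ) ^ (0 + 1)) + 2 * ((((4 : ℕ) : ℝ) - 1) * ((((2 : ℕ) : ℝ) ^ (0 + 1)) - 1) *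
      (1 / 10 ^ 53 : ℝ))) ^ 2 * (64 : ℝ) ^ (4 : ℕ) * (4 * ((4 : ℕ) : ℝ) ^ 2 * ((((2 : ℕ) : ℝ) ^ (0 + 1)) - 1) ^ 2 * (1 / 10 ^ 53 : ℝ) + 16 * (4 : ℕ)
      * loopRad (4 : ℕ) (2 : ℕ) ((prop1Radius (4 : ℕ) (2 : ℕ))^[0] (1 / 10 ^ 53 : ℝ))) ^ 2 * (Fintype.card n : ℝ)) * 8 * (((2 : ℕ) : ℝ) ^ (0 + 1)) ^
      2) * ((3 * ((2 : ℝ) ^ ((4 : ℕ) + 1)) * ((((2 : ℕ) : ℝ) ^ (0 + 1)) ^ 2)⁻¹ + 3 * (((4 : ℕ) : ℝ) * (1 / (((2 : ℕ) : ℝ) ^ (0 + 1)) + 2 * ((((4 : ℕ)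
      : ℝ) - 1) * ((((2 : ℕ) : ℝ) ^ (0 + 1)) - 1) * (1 / 10 ^ 53 : ℝ))) ^ 2) * (2 * ((64 : ℝ) ^ (4 : ℕ)) * (((2 : ℝ) ^ (3 * (4 : ℕ) + 2)) * (4 :
      ℕ)))) * ((Fintype.card n : ℝ) * (2 * (((2 : ℕ) : ℝ) ^ (0 + 1)) ^ 2 + 2 * (4 * (2 * ((4 * (4 : ℕ) + 5) / 10 * DSum (4 : ℕ) (2 : ℕ) (0 + 1) (1 /
      10 ^ 53 : ℝ))) ^ 2 * (((2 : ℕ) : ℝ) ^ (0 + 1)) ^ 2) * (Fintype.card n : ℝ))) + (12 * (4 : ℕ) * (48 * (((4 : ℕ) : ℝ) * ((2 : ℕ) : ℝ))) + 3 *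
      (((4 : ℕ) : ℝ) * (1 / (((2 : ℕ) : ℝ) ^ (0 + 1)) + 2 * ((((4 : ℕ) : ℝ) - 1) * ((((2 : ℕ) : ℝ) ^ (0 + 1)) - 1) * (1 / 10 ^ 53 : ℝ))) ^ 2) * (2 *
      ((64 : ℝ) ^ (4 : ℕ)) * (48 * (((4 : ℕ) : ℝ) * ((2 : ℕ) : ℝ))))) * (Fintype.card n : ℝ))))) (periodBox (d := 4) (N * (2 : ℕ) ^ (0 + 1))) :=
  NE3SlicePoincareCurved.slicePoincare_frameFreeBlockLandauW (d := 4) (L := 2) (x := 1 / 10 ^ 53) (ε := 1 / 10 ^ 17)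
    (by norm_num) (by norm_num) hN 0 hWu hWP (by norm_num) (levelSmall_level_one rfl) hWx (S2sum_le_half_rho_level_one rfl)
    (xi_small_level_one hn rfl) (by norm_num)
    (budget_lines_hold_level_one (c := Fintype.card n) rfl rfl hn rfl rfl rfl rfl rfl rfl rfl rfl).1
    (budget_lines_hold_level_one (c := Fintype.card n) rfl rfl hn rfl rfl rfl rfl rfl rfl rfl rfl).2


/-! ## §2 The hypothesis-free inhabitant (flat background, `n = Fin 2`, `N = 1`) -/

/-- **(P♮)_W FIRES WITH NO HYPOTHESIS LEFT**: at `n = Fin 2`, `N = 1`, `W = flatCfg` (unitary `isUnitaryCfg_flatCfg`, periodic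
`isPeriodicCfg_flatCfg`, `SmallField flatCfg 0 ≤ 10⁻⁵³` by `SmallField.mono`) §1 yields K6c-2b's conclusion outright — the referee's
INFO-68 joint-satisfiability probe (pass 27 b) as a tree theorem; the constant is §1's (left existential here only to keep the line short). [folklore] -/
theorem slicePoincare_level_one_flat :
    ∃ C : ℝ, SlicePoincare 2 (0 + 1) (flatCfg : Site 4 → Fin 4 → (Matrix (Fin 2) (Fin 2) ℂ)ˣ)
      (frameFreeBlockLandauW (d := 4) (n := Fin 2) 2 1 (0 + 1) flatCfg) C (periodBox (d := 4) (1 * 2 ^ (0 + 1))) :=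
  ⟨_, slicePoincare_level_one (n := Fin 2) (Fintype.card_fin 2) (N := 1) le_rfl isUnitaryCfg_flatCfg (isPeriodicCfg_flatCfg _)
    (MinimalActionRate.SmallField.mono smallField_flatCfg_zero (by norm_num))⟩

/-! ## §3 SU(3): the same level-one instance at `Fintype.card n = 3` (v1.1 of the witness file) -/

/-- **(P♮)_W AT LEVEL ONE FOR `card n = 3`**: §1 verbatim with `hn : Fintype.card n = 3`, the numeric binders now supplied by
`NE3SlicePoincareBudgetWitness.budget_lines_hold_level_one_three` ∕ `xi_small_level_one_three` (v1.1, p238875); same point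
d = 4, L = 2, k = 0, x = 10⁻⁵³, ε = 10⁻¹⁷; same displayed constant (it depends on `n` only through `Fintype.card n`). [folklore] -/
theorem slicePoincare_level_one_three {n : Type*} [Fintype n] [DecidableEq n] [Nonempty n] (hn : Fintype.card n = 3)
    {N : ℕ} (hN : 1 ≤ N) {W : Site 4 → Fin 4 → (Matrix n n ℂ)ˣ} (hWu : IsUnitaryCfg W)
    (hWP : IsPeriodicCfg W ((tower 2 N (0 + 1) : ℕ) : ℤ)) (hWx : SmallField W (1 / 10 ^ 53)) :
    SlicePoincare (2 : ℕ) (0 + 1) W (frameFreeBlockLandauW (d := 4) (n := n) (2 : ℕ) N (0 + 1) W)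
      ((Fintype.card n : ℝ) * (16 * (18 + 1 / 4 +
      16 * (2 * (8 * loopRad (4 : ℕ) (2 : ℕ) ((prop1Radius (4 : ℕ) (2 : ℕ))^[0] (1 / 10 ^ 53 : ℝ))) + 2 * (2 * ((((4 : ℕ) : ℝ) - 1) * ((((2 : ℕ) : ℝ)
      ^ (0 + 1)) - 1) * (((2 : ℕ) : ℝ) ^ (0 + 1)) * (1 / 10 ^ 53 : ℝ)))) * (Real.sqrt ((Fintype.card n : ℝ))) / (1 / 10 ^ 17 : ℝ) ^ 2) * (1 + (1 + 8
      * (1 / 10 ^ 17 : ℝ)) * (2 + (16 * ((4 : ℕ) : ℝ) * (1 / (((2 : ℕ) : ℝ) ^ (0 + 1)) + 2 * ((((4 : ℕ) : ℝ) - 1) * ((((2 : ℕ) : ℝ) ^ (0 + 1)) - 1) *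
      (1 / 10 ^ 53 : ℝ))) ^ 2 * (64 : ℝ) ^ (4 : ℕ) * (4 * ((4 : ℕ) : ℝ) ^ 2 * ((((2 : ℕ) : ℝ) ^ (0 + 1)) - 1) ^ 2 * (1 / 10 ^ 53 : ℝ) + 16 * (4 : ℕ)
      * loopRad (4 : ℕ) (2 : ℕ) ((prop1Radius (4 : ℕ) (2 : ℕ))^[0] (1 / 10 ^ 53 : ℝ))) ^ 2 * (Fintype.card n : ℝ)) * 8 * (((2 : ℕ) : ℝ) ^ (0 + 1)) ^
      2) * ((3 * ((2 : ℝ) ^ ((4 : ℕ) + 1)) * ((((2 : ℕ) : ℝ) ^ (0 + 1)) ^ 2)⁻¹ + 3 * (((4 : ℕ) : ℝ) * (1 / (((2 : ℕ) : ℝ) ^ (0 + 1)) + 2 * ((((4 : ℕ)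
      : ℝ) - 1) * ((((2 : ℕ) : ℝ) ^ (0 + 1)) - 1) * (1 / 10 ^ 53 : ℝ))) ^ 2) * (2 * ((64 : ℝ) ^ (4 : ℕ)) * (((2 : ℝ) ^ (3 * (4 : ℕ) + 2)) * (4 :
      ℕ)))) * ((Fintype.card n : ℝ) * (2 * (((2 : ℕ) : ℝ) ^ (0 + 1)) ^ 2 + 2 * (4 * (2 * ((4 * (4 : ℕ) + 5) / 10 * DSum (4 : ℕ) (2 : ℕ) (0 + 1) (1 /
      10 ^ 53 : ℝ))) ^ 2 * (((2 : ℕ) : ℝ) ^ (0 + 1)) ^ 2) * (Fintype.card n : ℝ))) + (12 * (4 : ℕ) * (48 * (((4 : ℕ) : ℝ) * ((2 : ℕ) : ℝ))) + 3 *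
      (((4 : ℕ) : ℝ) * (1 / (((2 : ℕ) : ℝ) ^ (0 + 1)) + 2 * ((((4 : ℕ) : ℝ) - 1) * ((((2 : ℕ) : ℝ) ^ (0 + 1)) - 1) * (1 / 10 ^ 53 : ℝ))) ^ 2) * (2 *
      ((64 : ℝ) ^ (4 : ℕ)) * (48 * (((4 : ℕ) : ℝ) * ((2 : ℕ) : ℝ))))) * (Fintype.card n : ℝ))))) (periodBox (d := 4) (N * (2 : ℕ) ^ (0 + 1))) :=
  NE3SlicePoincareCurved.slicePoincare_frameFreeBlockLandauW (d := 4) (L := 2) (x := 1 / 10 ^ 53) (ε := 1 / 10 ^ 17)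
    (by norm_num) (by norm_num) hN 0 hWu hWP (by norm_num) (levelSmall_level_one rfl) hWx (S2sum_le_half_rho_level_one rfl)
    (xi_small_level_one_three hn rfl) (by norm_num)
    (budget_lines_hold_level_one_three (c := Fintype.card n) rfl rfl hn rfl rfl rfl rfl rfl rfl rfl rfl).1
    (budget_lines_hold_level_one_three (c := Fintype.card n) rfl rfl hn rfl rfl rfl rfl rfl rfl rfl rfl).2

end

end Summit.QuantumFields.BalabanUV.T4Continuum.NE3SlicePoincareLevelOne
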